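import Literature.AnabelianGeometry.EtaleTheta.ThetaCovers
import Mathlib.GroupTheory.SemidirectProduct
import Mathlib.Algebra.GroupWithZero.Units.Fintype
import Mathlib.Data.Int.Order.Units
import Mathlib.Algebra.Group.PUnit
import Mathlib.Tactic.LinearCombination

/-!
# The abelian SIGN TOYS `(ℤ/l)³ ⋊ ℤˣ` for the theta-covering interface ([EtTh] §2, Def 2.1 / Prop 2.2 (i))

Mochizuki, *The Étale Theta Function and its Frobenioid-theoretic Manifestations* [EtTh], Publ. RIMS
45 (2009), §2, PRIMS text pp.35–37 (bib key `MochizukiEtTh2009`). Prop 2.2 (i), p.37: "The conjugation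
action of `ι̲` on the rank two `(ℤ/lℤ)`-module `Δ̄_X̲` determines a direct product decomposition
`Δ̄_X̲ ≅ Δ̄^ell_X̲ × Δ̄_Θ` into eigenspaces, with eigenvalues `−1` and `1`, respectively".

TOY MODELS of the TYPED interface `ThetaCovers.CoverData l` (`ThetaCovers.lean`, seat abc-iut-L2-t2;
nothing there is edited or restated), one for every odd `l` and every pair of flags `se sθ : Bool`:
`Π_C := (ℤ/l × ℤ/l × ℤ/l) ⋊ ℤˣ`, where `u ∈ ℤˣ = {±1}` multiplies the two "ell" coordinates `a, b` by
`u` if `se` (else fixes them) and the "theta" coordinate `c` by `u` if `sθ` (else fixes it);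
`Π_X := (ℤ/l)³ ⋊ 1`, `G_K := 1`, `Ker(Δ_X ↠ Δ̄_X) := 1`, `Δ̄_Θ := c`-axis `= D_x`, discrete topology.
Main definition: `SignToy.signToy l se sθ hl : CoverData l` — all `CoverData` axioms hold for all four
sign patterns (this file). The sequel `ThetaCoversProp22iSignToyIndependence.lean` shows that the
two `ι`-eigenvalue axioms `inv_ell` / `inv_theta` of `CoverDataAx` (`ThetaCoversAxioms.lean`) hold in
the toy iff `se` / iff `¬ sθ`, and that Prop 2.2 (i) (`CoverData.Prop22_i`, FACT-LIST F-0596) holds in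
the toy iff `(se, sθ) = (true, false)` — so each eigenvalue axiom is NECESSARY at the interface and the
universal closure of `Prop22_i` over the bare `CoverData` is refuted.

HONEST SCOPE. Consistency/independence toys at the typed interface; toy ≠ print (in print `ι` is the
elliptic inversion and `Δ_Θ = [Δ_X, Δ_X]`; here `Δ_X` is abelian). Pattern of
`ThetaCoversHeisenbergWitness.lean` (abc-iut-w5-d243), consumed by name only. Nothing here takes a side
on anything printed. abc-iut cell, seat abc-iut-w6-d081 (W6 row EtTh:Prop2.2(i)).
[cite: MochizukiEtTh2009, Def 2.1 p.36] [cite: MochizukiEtTh2009, Prop 2.2(i) p.37]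
-/

namespace Literature.AnabelianGeometry.EtaleTheta

namespace ThetaCovers

namespace SignToy

open Multiplicative

variable (l : ℕ) (se sθ : Bool)

/-! ## 1. The sign characters and the action of `ℤˣ` on `(ℤ/l)³` -/

/-- The sign by which `u ∈ ℤˣ` acts on a coordinate carrying the flag `s`: `u` if `s`, else `1`
(as an element of `ℤ/l`). (toy bookkeeping for the typed interface of [EtTh] Prop 2.2 (i); no claim
about print) [cite: MochizukiEtTh2009, Prop 2.2(i) p.37] -/
def sgn (s : Bool) (u : ℤˣ) : ZMod l := bif s then ((u : ℤ) : ZMod l) else 1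

/-- `sgn s 1 = 1`. (toy bookkeeping; no claim about print) [cite: MochizukiEtTh2009, Prop 2.2(i) p.37] -/
@[simp] theorem sgn_one (s : Bool) : sgn l s 1 = 1 := by cases s <;> simp [sgn]

/-- `sgn s` is multiplicative. (toy bookkeeping; no claim about print)
[cite: MochizukiEtTh2009, Prop 2.2(i) p.37] -/
theorem sgn_mul (s : Bool) (u v : ℤˣ) : sgn l s (u * v) = sgn l s u * sgn l s v := by
  cases s <;> simp [sgn, Units.val_mul, Int.cast_mul]

/-- `sgn s u` is an involution: `(sgn s u)² = 1`. (toy bookkeeping; no claim about print)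
[cite: MochizukiEtTh2009, Prop 2.2(i) p.37] -/
@[simp] theorem sgn_mul_self (s : Bool) (u : ℤˣ) : sgn l s u * sgn l s u = 1 := by
  rw [← sgn_mul, Int.units_mul_self, sgn_one]

/-- `sgn s u⁻¹ = sgn s u` (`u⁻¹ = u` in `ℤˣ`). (toy bookkeeping; no claim about print)
[cite: MochizukiEtTh2009, Prop 2.2(i) p.37] -/
@[simp] theorem sgn_inv (s : Bool) (u : ℤˣ) : sgn l s u⁻¹ = sgn l s u := by
  rw [Int.units_inv_eq_self]

/-- The flag `false` gives the trivial character. (toy bookkeeping; no claim about print)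
[cite: MochizukiEtTh2009, Prop 2.2(i) p.37] -/
@[simp] theorem sgn_false (u : ℤˣ) : sgn l false u = 1 := rfl

/-- The flag `true` on `−1` gives `−1`. (toy bookkeeping; no claim about print)
[cite: MochizukiEtTh2009, Prop 2.2(i) p.37] -/
@[simp] theorem sgn_true_neg_one : sgn l true (-1) = -1 := by simp [sgn]

/-- The action of `u ∈ ℤˣ` on additive triples `(a, b, c)`: `(sgn se u · a, sgn se u · b, sgn sθ u · c)`.
(toy bookkeeping; no claim about print) [cite: MochizukiEtTh2009, Prop 2.2(i) p.37] -/
def actFun (u : ℤˣ) (x : ZMod l × ZMod l × ZMod l) : ZMod l × ZMod l × ZMod l :=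
  (sgn l se u * x.1, sgn l se u * x.2.1, sgn l sθ u * x.2.2)

/-- `actFun` is additive. (toy bookkeeping; no claim about print) [cite: MochizukiEtTh2009, Prop 2.2(i) p.37] -/
theorem actFun_add (u : ℤˣ) (x y : ZMod l × ZMod l × ZMod l) :
    actFun l se sθ u (x + y) = actFun l se sθ u x + actFun l se sθ u y := by
  simp only [actFun, Prod.fst_add, Prod.snd_add, mul_add, Prod.mk_add_mk]

/-- `actFun 1 = id`. (toy bookkeeping; no claim about print) [cite: MochizukiEtTh2009, Prop 2.2(i) p.37] -/
theorem actFun_one (x : ZMod l × ZMod l × ZMod l) : actFun l se sθ 1 x = x := by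
  simp [actFun]

/-- `actFun u ∘ actFun v = actFun (u v)`. (toy bookkeeping; no claim about print)
[cite: MochizukiEtTh2009, Prop 2.2(i) p.37] -/
theorem actFun_actFun (u v : ℤˣ) (x : ZMod l × ZMod l × ZMod l) :
    actFun l se sθ u (actFun l se sθ v x) = actFun l se sθ (u * v) x := by
  simp only [actFun, sgn_mul, mul_assoc]

/-- `actFun u` is an involution. (toy bookkeeping; no claim about print)
[cite: MochizukiEtTh2009, Prop 2.2(i) p.37] -/
theorem actFun_actFun_self (u : ℤˣ) (x : ZMod l × ZMod l × ZMod l) :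
    actFun l se sθ u (actFun l se sθ u x) = x := by
  rw [actFun_actFun, Int.units_mul_self, actFun_one]

/-- The action of `u ∈ ℤˣ` on `(ℤ/l)³` (written multiplicatively) as a group automorphism.
(toy bookkeeping; no claim about print) [cite: MochizukiEtTh2009, Prop 2.2(i) p.37] -/
def act (u : ℤˣ) : MulAut (Multiplicative (ZMod l × ZMod l × ZMod l)) where
  toFun x := ofAdd (actFun l se sθ u x.toAdd)
  invFun x := ofAdd (actFun l se sθ u x.toAdd)
  left_inv x := by
    apply toAdd.injective
    simp only [toAdd_ofAdd, actFun_actFun_self]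
  right_inv x := by
    apply toAdd.injective
    simp only [toAdd_ofAdd, actFun_actFun_self]
  map_mul' x y := by
    apply toAdd.injective
    simp only [toAdd_mul, toAdd_ofAdd, actFun_add]

/-- `act` in coordinates. (toy bookkeeping; no claim about print) [cite: MochizukiEtTh2009, Prop 2.2(i) p.37] -/
@[simp] theorem toAdd_act (u : ℤˣ) (x : Multiplicative (ZMod l × ZMod l × ZMod l)) :
    toAdd (act l se sθ u x) = actFun l se sθ u x.toAdd := rfl

/-- The action homomorphism `ℤˣ → Aut((ℤ/l)³)`. (toy bookkeeping; no claim about print)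
[cite: MochizukiEtTh2009, Prop 2.2(i) p.37] -/
def phi : ℤˣ →* MulAut (Multiplicative (ZMod l × ZMod l × ZMod l)) where
  toFun := act l se sθ
  map_one' := by
    ext x : 1
    apply toAdd.injective
    simp only [toAdd_act, actFun_one, MulAut.one_apply]
  map_mul' u v := by
    ext x : 1
    apply toAdd.injective
    simp only [toAdd_act, MulAut.mul_apply, actFun_actFun]

/-- `phi u = act u`. (toy bookkeeping; no claim about print) [cite: MochizukiEtTh2009, Prop 2.2(i) p.37] -/
@[simp] theorem phi_apply (u : ℤˣ) : phi l se sθ u = act l se sθ u := rfl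

/-! ## 2. The group `Π_C := (ℤ/l)³ ⋊ ℤˣ` and its coordinates -/

/-- **`Π_C` of the sign toy**: `(ℤ/l × ℤ/l × ℤ/l) ⋊ ℤˣ` for the sign pattern `(se, sθ)`.
(toy bookkeeping for the typed interface of [EtTh] Def 2.1 / Prop 2.2; no claim about print)
[cite: MochizukiEtTh2009, Prop 2.2(i) p.37] -/
abbrev G : Type := Multiplicative (ZMod l × ZMod l × ZMod l) ⋊[phi l se sθ] ℤˣ

variable {l se sθ}

/-- First ell-coordinate `a`. (toy bookkeeping; no claim about print) [cite: MochizukiEtTh2009, Prop 2.2(i) p.37] -/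
def ca (x : G l se sθ) : ZMod l := (toAdd x.left).1

/-- Second ell-coordinate `b`. (toy bookkeeping; no claim about print) [cite: MochizukiEtTh2009, Prop 2.2(i) p.37] -/
def cb (x : G l se sθ) : ZMod l := (toAdd x.left).2.1

/-- Theta-coordinate `c`. (toy bookkeeping; no claim about print) [cite: MochizukiEtTh2009, Prop 2.2(i) p.37] -/
def cc (x : G l se sθ) : ZMod l := (toAdd x.left).2.2

/-- Extensionality in coordinates. (toy bookkeeping; no claim about print) [cite: MochizukiEtTh2009, Prop 2.2(i) p.37] -/
theorem ext_coords {x y : G l se sθ} (h1 : ca x = ca y) (h2 : cb x = cb y) (h3 : cc x = cc y)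
    (h4 : x.right = y.right) : x = y :=
  SemidirectProduct.ext (toAdd.injective (Prod.ext h1 (Prod.ext h2 h3))) h4

/-- `a` of a product. (toy bookkeeping; no claim about print) [cite: MochizukiEtTh2009, Prop 2.2(i) p.37] -/
@[simp] theorem ca_mul (x y : G l se sθ) : ca (x * y) = ca x + sgn l se x.right * ca y := rfl

/-- `b` of a product. (toy bookkeeping; no claim about print) [cite: MochizukiEtTh2009, Prop 2.2(i) p.37] -/
@[simp] theorem cb_mul (x y : G l se sθ) : cb (x * y) = cb x + sgn l se x.right * cb y := rfl

/-- `c` of a product. (toy bookkeeping; no claim about print) [cite: MochizukiEtTh2009, Prop 2.2(i) p.37] -/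
@[simp] theorem cc_mul (x y : G l se sθ) : cc (x * y) = cc x + sgn l sθ x.right * cc y := rfl

/-- `a` of an inverse. (toy bookkeeping; no claim about print) [cite: MochizukiEtTh2009, Prop 2.2(i) p.37] -/
@[simp] theorem ca_inv (x : G l se sθ) : ca x⁻¹ = -(sgn l se x.right * ca x) := by
  show sgn l se x.right⁻¹ * -(toAdd x.left).1 = _
  rw [sgn_inv, mul_neg]; rfl

/-- `b` of an inverse. (toy bookkeeping; no claim about print) [cite: MochizukiEtTh2009, Prop 2.2(i) p.37] -/
@[simp] theorem cb_inv (x : G l se sθ) : cb x⁻¹ = -(sgn l se x.right * cb x) := by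
  show sgn l se x.right⁻¹ * -(toAdd x.left).2.1 = _
  rw [sgn_inv, mul_neg]; rfl

/-- `c` of an inverse. (toy bookkeeping; no claim about print) [cite: MochizukiEtTh2009, Prop 2.2(i) p.37] -/
@[simp] theorem cc_inv (x : G l se sθ) : cc x⁻¹ = -(sgn l sθ x.right * cc x) := by
  show sgn l sθ x.right⁻¹ * -(toAdd x.left).2.2 = _
  rw [sgn_inv, mul_neg]; rfl

/-- `a` of `1`. (toy bookkeeping; no claim about print) [cite: MochizukiEtTh2009, Prop 2.2(i) p.37] -/
@[simp] theorem ca_one : ca (1 : G l se sθ) = 0 := rfl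

/-- `b` of `1`. (toy bookkeeping; no claim about print) [cite: MochizukiEtTh2009, Prop 2.2(i) p.37] -/
@[simp] theorem cb_one : cb (1 : G l se sθ) = 0 := rfl

/-- `c` of `1`. (toy bookkeeping; no claim about print) [cite: MochizukiEtTh2009, Prop 2.2(i) p.37] -/
@[simp] theorem cc_one : cc (1 : G l se sθ) = 0 := rfl

/-- Coordinates of `inl (a, b, c)`. (toy bookkeeping; no claim about print) [cite: MochizukiEtTh2009, Prop 2.2(i) p.37] -/
@[simp] theorem coords_inl (a b c : ZMod l) :
    ca (SemidirectProduct.inl (ofAdd (a, b, c)) : G l se sθ) = a ∧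
      cb (SemidirectProduct.inl (ofAdd (a, b, c)) : G l se sθ) = b ∧
      cc (SemidirectProduct.inl (ofAdd (a, b, c)) : G l se sθ) = c :=
  ⟨rfl, rfl, rfl⟩

/-- Coordinates of `inr u`. (toy bookkeeping; no claim about print) [cite: MochizukiEtTh2009, Prop 2.2(i) p.37] -/
@[simp] theorem coords_inr (u : ℤˣ) :
    ca (SemidirectProduct.inr u : G l se sθ) = 0 ∧ cb (SemidirectProduct.inr u : G l se sθ) = 0 ∧
      cc (SemidirectProduct.inr u : G l se sθ) = 0 :=
  ⟨rfl, rfl, rfl⟩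

/-- Conjugation acts on `(ℤ/l)³ ⋊ 1` through the signs: coordinates of `g t g⁻¹` for `t ∈ (ℤ/l)³ ⋊ 1`.
(toy bookkeeping; no claim about print) [cite: MochizukiEtTh2009, Prop 2.2(i) p.37] -/
theorem conj_coords (g t : G l se sθ) (ht : t.right = 1) :
    ca (g * t * g⁻¹) = sgn l se g.right * ca t ∧ cb (g * t * g⁻¹) = sgn l se g.right * cb t ∧
      cc (g * t * g⁻¹) = sgn l sθ g.right * cc t ∧ (g * t * g⁻¹).right = 1 := by
  refine ⟨?_, ?_, ?_, ?_⟩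
  · simp only [ca_mul, ca_inv, SemidirectProduct.mul_right, ht, mul_one]
    linear_combination (-(ca g)) * sgn_mul_self l se g.right
  · simp only [cb_mul, cb_inv, SemidirectProduct.mul_right, ht, mul_one]
    linear_combination (-(cb g)) * sgn_mul_self l se g.right
  · simp only [cc_mul, cc_inv, SemidirectProduct.mul_right, ht, mul_one]
    linear_combination (-(cc g)) * sgn_mul_self l sθ g.right
  · simp only [SemidirectProduct.mul_right, SemidirectProduct.inv_right, ht, mul_one, mul_inv_cancel]

/-! ## 3. The subgroups `Π_X`, `Δ̄_Θ`, `Π_C̲` -/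

variable (l se sθ)

/-- **`Π_X` of the toy**: `(ℤ/l)³ ⋊ 1 = Ker(Π_C ↠ ℤˣ)`. (toy bookkeeping; no claim about print)
[cite: MochizukiEtTh2009, Def 2.1 p.36] -/
def PiX : Subgroup (G l se sθ) := (SemidirectProduct.rightHom).ker

/-- Membership in `Π_X`: the `ℤˣ`-component is `1`. (toy bookkeeping; no claim about print)
[cite: MochizukiEtTh2009, Def 2.1 p.36] -/
theorem mem_PiX {x : G l se sθ} : x ∈ PiX l se sθ ↔ x.right = 1 := Iff.rfl

/-- **`Δ̄_Θ`-preimage of the toy** (also `D_x`): the `c`-axis `{(0, 0, c)} ⋊ 1`. (toy bookkeeping; no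
claim about print) [cite: MochizukiEtTh2009, Def 2.1 p.36] -/
def Theta : Subgroup (G l se sθ) where
  carrier := {x | x.right = 1 ∧ ca x = 0 ∧ cb x = 0}
  mul_mem' := by
    rintro x y ⟨hx1, hx2, hx3⟩ ⟨hy1, hy2, hy3⟩
    exact ⟨by simp [hx1, hy1], by simp [hx2, hy2], by simp [hx3, hy3]⟩
  one_mem' := ⟨rfl, rfl, rfl⟩
  inv_mem' := by
    rintro x ⟨h1, h2, h3⟩
    exact ⟨by simp [h1], by simp [h2], by simp [h3]⟩

/-- Membership in `Δ̄_Θ`. (toy bookkeeping; no claim about print) [cite: MochizukiEtTh2009, Def 2.1 p.36] -/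
theorem mem_Theta {x : G l se sθ} : x ∈ Theta l se sθ ↔ x.right = 1 ∧ ca x = 0 ∧ cb x = 0 := Iff.rfl

/-- `Δ̄_Θ ⊆ Π_X`. (toy bookkeeping; no claim about print) [cite: MochizukiEtTh2009, Def 2.1 p.36] -/
theorem Theta_le_PiX : Theta l se sθ ≤ PiX l se sθ := fun _ hx => hx.1

/-- `Δ̄_Θ` is normal in `Π_C`. (toy bookkeeping; no claim about print) [cite: MochizukiEtTh2009, Def 2.1 p.36] -/
theorem Theta_normal : (Theta l se sθ).Normal := by
  refine ⟨fun t ht g => ?_⟩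
  obtain ⟨h1, h2, h3⟩ := ht
  obtain ⟨e1, e2, -, e4⟩ := conj_coords g t h1
  exact ⟨e4, by rw [e1, h2, mul_zero], by rw [e2, h3, mul_zero]⟩

/-- The embedding `c ↦ (0, 0, c)` of `ℤ/l` onto `Δ̄_Θ`. (toy bookkeeping; no claim about print)
[cite: MochizukiEtTh2009, Def 2.1 p.36] -/
def thetaEmb : Multiplicative (ZMod l) →* G l se sθ :=
  SemidirectProduct.inl.comp (AddMonoidHom.toMultiplicative
    ((AddMonoidHom.inr (ZMod l) (ZMod l × ZMod l)).comp (AddMonoidHom.inr (ZMod l) (ZMod l))))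

/-- Coordinates of `thetaEmb c`. (toy bookkeeping; no claim about print) [cite: MochizukiEtTh2009, Def 2.1 p.36] -/
theorem coords_thetaEmb (c : Multiplicative (ZMod l)) :
    ca (thetaEmb l se sθ c) = 0 ∧ cb (thetaEmb l se sθ c) = 0 ∧ cc (thetaEmb l se sθ c) = c.toAdd ∧
      (thetaEmb l se sθ c).right = 1 :=
  ⟨rfl, rfl, rfl, rfl⟩

/-- `Δ̄_Θ` is the image of `thetaEmb`. (toy bookkeeping; no claim about print) [cite: MochizukiEtTh2009, Def 2.1 p.36] -/
theorem Theta_eq_range : Theta l se sθ = (thetaEmb l se sθ).range := by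
  ext x
  rw [mem_Theta, MonoidHom.mem_range]
  constructor
  · rintro ⟨h1, h2, h3⟩
    obtain ⟨e1, e2, e3, e4⟩ := coords_thetaEmb l se sθ (ofAdd (cc x))
    exact ⟨ofAdd (cc x), ext_coords (e1.trans h2.symm) (e2.trans h3.symm) e3 (e4.trans h1.symm)⟩
  · rintro ⟨c, rfl⟩
    obtain ⟨e1, e2, -, e4⟩ := coords_thetaEmb l se sθ c
    exact ⟨e4, e1, e2⟩

/-- `thetaEmb` is injective. (toy bookkeeping; no claim about print) [cite: MochizukiEtTh2009, Def 2.1 p.36] -/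
theorem thetaEmb_injective : Function.Injective (thetaEmb l se sθ) := by
  intro c d h
  have := (coords_thetaEmb l se sθ c).2.2.1.symm.trans ((congrArg cc h).trans (coords_thetaEmb l se sθ d).2.2.1)
  exact toAdd.injective this

/-- `|Δ̄_Θ| = l`. (toy bookkeeping; no claim about print) [cite: MochizukiEtTh2009, Def 2.1 p.36] -/
theorem card_Theta : Nat.card (Theta l se sθ) = l := by
  rw [Theta_eq_range, ← Nat.card_congr (MonoidHom.ofInjective (thetaEmb_injective l se sθ)).toEquiv,
    Nat.card_congr (Multiplicative.toAdd : Multiplicative (ZMod l) ≃ ZMod l), Nat.card_zmod]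

/-- `[Π_C : Π_X] = 2`. (toy bookkeeping; no claim about print) [cite: MochizukiEtTh2009, Def 2.1 p.36] -/
theorem index_PiX : (PiX l se sθ).index = 2 := by
  rw [PiX, Subgroup.index_ker, MonoidHom.range_eq_top.mpr SemidirectProduct.rightHom_surjective,
    Subgroup.card_top, Nat.card_eq_fintype_card, Fintype.card_units_int]

/-- Everything lies in the kernel of the trivial augmentation `Π_C → G_K = 1`. (toy bookkeeping; no
claim about print) [cite: MochizukiEtTh2009, Def 2.1 p.36] -/
theorem mem_ker_one (x : G l se sθ) : x ∈ (1 : G l se sθ →* PUnit).ker :=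
  MonoidHom.mem_ker.mpr (Subsingleton.elim _ _)

/-- `Π_X ∩ Ker(1) = Π_X`. (toy bookkeeping; no claim about print) [cite: MochizukiEtTh2009, Def 2.1 p.36] -/
theorem PiX_inf_ker_one : PiX l se sθ ⊓ (1 : G l se sθ →* PUnit).ker = PiX l se sθ :=
  le_antisymm inf_le_left fun x hx => ⟨hx, mem_ker_one l se sθ x⟩

/-- The ell-coordinates `(a, b)` on `Δ_X = Π_X` (a homomorphism onto `(ℤ/l)²` with kernel `Δ̄_Θ`) — the
typed "`Δ̄^ell_X` is a free `(ℤ/lℤ)`-module of rank `2`". (toy bookkeeping; no claim about print)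
[cite: MochizukiEtTh2009, Def 2.1 p.36] -/
def ellCoords : ↥(PiX l se sθ ⊓ (1 : G l se sθ →* PUnit).ker) →* Multiplicative (ZMod l × ZMod l) where
  toFun x := ofAdd (ca x.1, cb x.1)
  map_one' := rfl
  map_mul' x y := by
    have hx : x.1.right = 1 := x.2.1
    apply toAdd.injective
    simp only [Subgroup.coe_mul, toAdd_ofAdd, toAdd_mul, ca_mul, cb_mul, hx, sgn_one, one_mul,
      Prod.mk_add_mk]

/-- `ellCoords` is surjective. (toy bookkeeping; no claim about print) [cite: MochizukiEtTh2009, Def 2.1 p.36] -/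
theorem ellCoords_surjective : Function.Surjective (ellCoords l se sθ) := by
  intro y
  obtain ⟨⟨a, b⟩, rfl⟩ := Multiplicative.ofAdd.surjective y
  exact ⟨⟨SemidirectProduct.inl (ofAdd (a, b, 0)), rfl, mem_ker_one l se sθ _⟩, rfl⟩

/-- `Ker(ellCoords) = Δ̄_Θ`. (toy bookkeeping; no claim about print) [cite: MochizukiEtTh2009, Def 2.1 p.36] -/
theorem ellCoords_ker : (ellCoords l se sθ).ker = (Theta l se sθ).subgroupOf _ := by
  ext x
  have hx : x.1.right = 1 := x.2.1
  rw [MonoidHom.mem_ker, Subgroup.mem_subgroupOf, mem_Theta]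
  constructor
  · intro h
    have h' := congrArg toAdd h
    simp only [ellCoords, MonoidHom.coe_mk, OneHom.coe_mk, toAdd_ofAdd, toAdd_one,
      Prod.mk_eq_zero] at h'
    exact ⟨hx, h'.1, h'.2⟩
  · rintro ⟨-, h2, h3⟩
    apply toAdd.injective
    simp only [ellCoords, MonoidHom.coe_mk, OneHom.coe_mk, toAdd_ofAdd, toAdd_one, h2, h3]
    rfl

/-! ## 4. The four sign toys are `CoverData` -/

/-- **THE SIGN TOY** for the flags `(se, sθ)`: a `CoverData l` for every odd `l` (discrete topology,
`G_K = 1`, `Ker(Δ_X ↠ Δ̄_X) = 1`, `Δ̄_Θ = D_x =` the `c`-axis). TOY — not a claim of faithfulness to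
print. [cite: MochizukiEtTh2009, Def 2.1 p.36] -/
@[reducible] def signToy (hl : Odd l) : CoverData.{0} l :=
  letI : TopologicalSpace (G l se sθ) := ⊥
  haveI : DiscreteTopology (G l se sθ) := ⟨rfl⟩
  { l_odd := hl
    PiC := G l se sθ
    GK := PUnit
    aug := 1
    PiX := PiX l se sθ
    PiX_normal := MonoidHom.normal_ker _
    index_PiX := index_PiX l se sθ
    isOpen_PiX := isOpen_discrete _
    aug_PiX_surjective := fun _ => ⟨1, Subsingleton.elim _ _⟩
    barKer := ⊥
    barKer_normal := inferInstance
    isClosed_barKer := isClosed_discrete _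
    barTheta := Theta l se sθ
    barTheta_normal := Theta_normal l se sθ
    barKer_le_barTheta := bot_le
    barTheta_le := by rw [PiX_inf_ker_one]; exact Theta_le_PiX l se sθ
    relIndex_barKer := by rw [Subgroup.relIndex_bot_left, card_Theta]
    ell_rank_two := by
      haveI := Theta_normal l se sθ
      exact ⟨(QuotientGroup.quotientMulEquivOfEq (ellCoords_ker l se sθ).symm).trans
        (QuotientGroup.quotientKerEquivOfSurjective _ (ellCoords_surjective l se sθ))⟩
    barTheta_central := by
      intro t ht d hd
      rw [PiX_inf_ker_one] at hd
      obtain ⟨ht1, ht2, ht3⟩ := ht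
      have hd1 : d.right = 1 := hd
      rw [Subgroup.mem_bot]
      refine ext_coords ?_ ?_ ?_ ?_
      · simp [ht1, ht2, hd1]
      · simp [ht1, ht3, hd1]
      · simp only [cc_mul, cc_inv, SemidirectProduct.mul_right, SemidirectProduct.inv_right, ht1, hd1,
          sgn_one, one_mul, mul_one, inv_one, cc_one]
        ring
      · simp [ht1, hd1]
    Dx := Theta l se sθ
    Dx_le := Theta_le_PiX l se sθ
    aug_Dx_surjective := fun _ => ⟨1, Subsingleton.elim _ _⟩
    inertia_sup_barKer := by rw [MonoidHom.ker_one, inf_top_eq, sup_bot_eq] }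

end SignToy

end ThetaCovers

end Literature.AnabelianGeometry.EtaleTheta
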